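import Literature.Geometry.Lorentzian.FinalEraPackage2
import Literature.Geometry.Lorentzian.BoostedKerrCausalLegs
import Literature.Geometry.Lorentzian.MinkowskiGlobalHyperbolicity
import HarnessLib

/-!
# Stub H_hov `stub_hoverLeg` — the certified hover leg at Kerr–Schild radius `≥ 100 M`
# (crux `DispersingCapture`, stmt-FinalStateConjecture-17643, line `registered`, skeleton r10; lead prover c6, 2026-08-17)

Route `DissipativeFinalMotions` of the summit `FinalStateConjecture`. For a smooth chart `Ψ` of the rest-frame
Kerr–Schild background `Kerr.background M a` (`M ≥ 0`) into a vacuum Cauchy development, a domain point `x` of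
Kerr–Schild radius `≥ 100 M` and `s > 0`: if `‖Ψ^* g − g_{M,a}‖ ≤ 1/20` (operator norm of the deviation) at
every domain point of the coordinate segment `{x + θ e₀ : 0 ≤ θ ≤ s}` and `dΨ(V)` (`V = Kerr.timeVector M a`)
is future-directed at `x`, then `x + s e₀` is a domain point (same radius) and `Ψ x ∈ J⁻{Ψ(x + s e₀)}`.
Cone algebra: `g_{M,a}(e₀, e₀) = −1 + 2H ≤ −1 + 1/20` at `r ≥ 100 M` (`kerrBilin_ofTimeSpace_one_le`), so
`g(dΨ e₀, dΨ e₀) ≤ −9/10` along the segment; `g(dΨ V, dΨ e₀) ≤ −1 + ‖V‖/20 < 0` with `dΨ V` future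
timelike, so `dΨ e₀` is future-directed at `x` (`TimeOrientation.isFutureDirected_iff_val_neg`); the segment
is then a future causal curve (`leg_two_causal` / `segment_mem_causalFuture`,
`Literature.Geometry.Lorentzian.BoostedKerrCausalLegs`) and `mem_causalPast_singleton_iff` turns `J⁺` into `J⁻`.

References: O'Neill 1983, Ch. 5, Lemma 5.26, Lemma 5.29; Ch. 14, p. 402; Visser arXiv:0706.0622, (32)–(35);
Dafermos–Rodnianski arXiv:0811.0354, §5.1 (`V = −g♯(dt*)`).
-/

set_option linter.dupNamespace false

noncomputable section

open scoped Manifold ContDiff Topology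
open Filter Set Function MeasureTheory Literature.Geometry.Lorentzian

namespace Summit.FinalStateConjecture.FinalStateConjecture.Theorems.DissipativeFinalMotions.DispersingCapture

-- instance search through nested operator types `E4 →L[ℝ] E4 →L[ℝ] ℝ`
set_option maxSynthPendingDepth 3

/-- `‖e₀‖ = 1` in `E4`. [folklore] -/
private theorem norm_basisVector_zero' : ‖(E4.basisVector 0 : E4)‖ = 1 := by simp

/-- The time coordinate along the hover line: `(x + θ e₀)⁰ = x⁰ + θ`. [folklore] -/
private theorem add_smul_basisVector_zero_apply_zero (x : E4) (θ : ℝ) :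
    (x + θ • E4.basisVector 0) 0 = x 0 + θ := by simp

/-- The Kerr exterior is invariant under `t*`-translations (the radius is). [folklore] -/
private theorem mem_exterior_add_smul {M a : ℝ} {x : E4} (hx : x ∈ Kerr.exterior M a) (θ : ℝ) :
    x + θ • E4.basisVector 0 ∈ Kerr.exterior M a := by
  rw [Kerr.mem_exterior] at hx ⊢
  rwa [Kerr.radius_add_time_smul_basisVector]

/-- `H ≤ 1/100` at Kerr–Schild radius `r ≥ 100 M` (`H ≤ M / r`). Visser arXiv:0706.0622, (33). [folklore] -/
private theorem scalarH_le_of_radius {M a : ℝ} (hM : 0 ≤ M) {x : E4} (hx : 0 < Kerr.radius a x)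
    (hr : 100 * M ≤ Kerr.radius a x) : Kerr.scalarH M a x ≤ 1 / 100 := by
  -- adapted from `val_mfderiv_lorentz_le` (Literature/Geometry/Lorentzian/BoostedKerrCausalLegs)
  calc Kerr.scalarH M a x ≤ M / Kerr.radius a x := Kerr.scalarH_le_div hM a hx
    _ ≤ 1 / 100 := by
        rw [div_le_div_iff₀ hx (by norm_num : (0 : ℝ) < 100)]
        linarith

/-- `‖V‖ ≤ 2` for the Kerr time vector `V = e₀ − 2H ℓ♯` when `H ≤ 1/100` (`‖ℓ♯‖² = 2`). [folklore] -/
private theorem norm_timeVector_le {M a : ℝ} (hM : 0 ≤ M) {x : E4} (hx : 0 < Kerr.radius a x)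
    (hH : Kerr.scalarH M a x ≤ 1 / 100) : ‖Kerr.timeVector M a x‖ ≤ 2 := by
  have hH0 := Kerr.scalarH_nonneg hM a x
  -- adapted from `norm_nullVector_sq` (Literature/Geometry/Lorentzian/KerrSchildFrame)
  have hl2 : ‖Kerr.nullVector a x‖ ^ 2 = 2 := by
    rw [EuclideanSpace.real_norm_sq_eq, Fin.sum_univ_four, Kerr.nullVector_apply_zero,
      Kerr.nullVector_apply_one, Kerr.nullVector_apply_two, Kerr.nullVector_apply_three]
    linear_combination Kerr.sum_sq_nullCovectorFun hx
  have hl : ‖Kerr.nullVector a x‖ ≤ 3 / 2 := by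
    nlinarith [norm_nonneg (Kerr.nullVector a x)]
  calc ‖Kerr.timeVector M a x‖
      ≤ ‖(E4.basisVector 0 : E4)‖ + ‖(2 * Kerr.scalarH M a x) • Kerr.nullVector a x‖ :=
        norm_sub_le _ _
    _ = 1 + 2 * Kerr.scalarH M a x * ‖Kerr.nullVector a x‖ := by
        rw [norm_basisVector_zero', norm_smul, Real.norm_eq_abs, abs_of_nonneg (by positivity)]
    _ ≤ 1 + 2 * (1 / 100) * (3 / 2) := by gcongr
    _ ≤ 2 := by norm_num

variable (𝓢 : Spacetime.{0} 4) in
/-- **Metric value of pushed-forward vectors under a deviation bound**: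
`g(dΨ v, dΨ w) ≤ g_B(v, w) + ‖Ψ^*g − g_B‖ ‖v‖ ‖w‖`. DHRT arXiv:2104.08222, §1. [folklore] -/
private theorem val_mfderiv_le_of_norm_deviation_le (B : ModelBackground) (Ψ : B.domain → 𝓢.carrier)
    (x : B.domain) {δ m : ℝ} (hdev : ‖𝓢.deviation B Ψ x‖ ≤ δ) (v w : E4) (hm : B.bilin x.1 v w ≤ m) :
    𝓢.metric.val (Ψ x) (mfderiv 𝓘(ℝ, E4) (𝓡 4) Ψ x v) (mfderiv 𝓘(ℝ, E4) (𝓡 4) Ψ x w) ≤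
      m + δ * ‖v‖ * ‖w‖ := by
  -- adapted from `val_mfderiv_le_of_norm_deviation_le` (Literature/Geometry/Lorentzian/BoostedKerrCausalLegs)
  have happ := 𝓢.deviation_apply B Ψ x v w
  have h1 : 𝓢.deviation B Ψ x v w ≤ ‖𝓢.deviation B Ψ x‖ * ‖v‖ * ‖w‖ :=
    (Real.le_norm_self _).trans ((𝓢.deviation B Ψ x).le_opNorm₂ v w)
  have h2 : ‖𝓢.deviation B Ψ x‖ * ‖v‖ * ‖w‖ ≤ δ * ‖v‖ * ‖w‖ := by gcongr
  linarith

variable (𝓢 : Spacetime.{0} 4) in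
/-- **Cone bound on the hover axis.** At a point of `Kerr.background M a` of radius `≥ 100 M` with
`‖Ψ^*g − g_{M,a}‖ ≤ 1/20`: `g(dΨ e₀, dΨ e₀) ≤ −9/10`, so `dΨ e₀` is timelike, hence causal.
O'Neill 1983, Ch. 5, Lemma 5.26; Visser arXiv:0706.0622, (32)–(35). [folklore] -/
private theorem val_mfderiv_basisVector_le {M : ℝ} (a : ℝ) (hM : 0 ≤ M)
    (Ψ : (Kerr.background M a).domain → 𝓢.carrier) (z : (Kerr.background M a).domain)
    (hr : 100 * M ≤ Kerr.radius a z.1) (hdev : ‖𝓢.deviation (Kerr.background M a) Ψ z‖ ≤ 1 / 20) :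
    𝓢.metric.val (Ψ z) (mfderiv 𝓘(ℝ, E4) (𝓡 4) Ψ z (E4.basisVector 0))
      (mfderiv 𝓘(ℝ, E4) (𝓡 4) Ψ z (E4.basisVector 0)) ≤ -(9 / 10) := by
  have hz : 0 < Kerr.radius a z.1 := Kerr.radius_pos_of_mem_region z.2
  have hH : Kerr.scalarH M a z.1 ≤ 1 / 100 := scalarH_le_of_radius hM hz hr
  have hmodel : (Kerr.background M a).bilin z.1 (E4.basisVector 0) (E4.basisVector 0) ≤ -1 + 1 / 20 := by
    have h := BoostedKerrLegs.kerrBilin_ofTimeSpace_one_le hM hz hH 0 0 (by simp) (by simp)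
    rw [BoostedKerrLegs.ofTimeSpace_one_zero, norm_zero, mul_zero, add_zero] at h
    exact h
  have h := val_mfderiv_le_of_norm_deviation_le 𝓢 (Kerr.background M a) Ψ z hdev _ _ hmodel
  rw [norm_basisVector_zero'] at h
  linarith

variable (𝓢 : Spacetime.{0} 4) in
/-- Under the hypotheses of `val_mfderiv_basisVector_le`, `dΨ e₀` is causal (indeed timelike).
O'Neill 1983, Ch. 5, Lemma 5.26. [folklore] -/
private theorem isCausal_mfderiv_basisVector {M : ℝ} (a : ℝ) (hM : 0 ≤ M)
    (Ψ : (Kerr.background M a).domain → 𝓢.carrier) (z : (Kerr.background M a).domain)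
    (hr : 100 * M ≤ Kerr.radius a z.1) (hdev : ‖𝓢.deviation (Kerr.background M a) Ψ z‖ ≤ 1 / 20) :
    𝓢.metric.IsCausal (mfderiv 𝓘(ℝ, E4) (𝓡 4) Ψ z (E4.basisVector 0)) := by
  have h := val_mfderiv_basisVector_le 𝓢 a hM Ψ z hr hdev
  refine ⟨by linarith, fun h0 ↦ ?_⟩
  have h00 : 𝓢.metric.val (Ψ z) (0 : TangentSpace (𝓡 4) (Ψ z)) (0 : TangentSpace (𝓡 4) (Ψ z)) = 0 := by
    simp
  rw [h0, h00] at h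
  linarith

/-- **H_hov — the certified hover leg.** For a smooth chart `Ψ` of `Kerr.background M a` (`0 ≤ M`), a domain
point `x` with `100 M ≤ r(x)` and `s > 0`: if the deviation `Ψ^*g − g_{M,a}` has operator norm `≤ 1/20` at every
domain point with the spatial coordinates of `x` and time in `[x⁰, x⁰ + s]`, and `dΨ(Kerr.timeVector M a x)` is
future-directed, then `x + s e₀` is a domain point and `Ψ x ∈ J⁻{Ψ(x + s e₀)}`. O'Neill 1983, Ch. 5,
Lemma 5.26 / 5.29, Ch. 14, p. 402; Visser arXiv:0706.0622, (32)–(35). -/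
theorem stub_hoverLeg : open scoped Manifold Topology in ∀ (X : Type) [TopologicalSpace X] [ChartedSpace (EuclideanSpace ℝ (Fin 3)) X] [IsManifold (𝓡 3) ((⊤ : ℕ∞) : WithTop ℕ∞) X] [T2Space X] [SecondCountableTopology X] [ConnectedSpace X], ∀ (D : Literature.Geometry.Lorentzian.InitialDataSet (𝓡 3) X) (𝒟 : Literature.Geometry.Lorentzian.VacuumCauchyDevelopment D) (M a : ℝ) (Ψ : (Literature.Geometry.Lorentzian.Kerr.background M a).domain → 𝒟.carrier) (x : (Literature.Geometry.Lorentzian.Kerr.background M a).domain) (s : ℝ), 0 ≤ M → 0 < s → ContMDiff 𝓘(ℝ, Literature.Geometry.Lorentzian.E4) (𝓡 4) ((⊤ : ℕ∞) : WithTop ℕ∞) Ψ → 100 * M ≤ Literature.Geometry.Lorentzian.Kerr.radius a x.1 → (∀ z : (Literature.Geometry.Lorentzian.Kerr.background M a).domain, x.1 0 ≤ z.1 0 → z.1 0 ≤ x.1 0 + s → Literature.Geometry.Lorentzian.E4.spatial z.1 = Literature.Geometry.Lorentzian.E4.spatial x.1 → ‖𝒟.toSpacetime.deviation (Literature.Geometry.Lorentzian.Kerr.background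 M a) Ψ z‖ ≤ 1 / 20) → 𝒟.toSpacetime.timeOrientation.IsFutureDirected (mfderiv 𝓘(ℝ, Literature.Geometry.Lorentzian.E4) (𝓡 4) Ψ x (Literature.Geometry.Lorentzian.Kerr.timeVector M a x.1)) →
    ∃ z : (Literature.Geometry.Lorentzian.Kerr.background M a).domain, z.1 = x.1 + s • Literature.Geometry.Lorentzian.E4.basisVector 0 ∧ Ψ x ∈ 𝒟.toSpacetime.metric.causalPast 𝒟.toSpacetime.timeOrientation {Ψ z} := by
  intro X _ _ _ _ _ _ D 𝒟 M a Ψ x s hM hs hΨ hr hdev hV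
  -- the segment `x + θ e₀`, `θ ∈ [0, s]`: in the domain, same radius, deviation `≤ 1/20`
  have hmem : ∀ θ : ℝ, x.1 + θ • E4.basisVector 0 ∈ ((Kerr.background M a).domain : Set E4) :=
    fun θ ↦ mem_exterior_add_smul x.2 θ
  have hrad : ∀ θ : ℝ, Kerr.radius a (x.1 + θ • E4.basisVector 0) = Kerr.radius a x.1 :=
    fun θ ↦ Kerr.radius_add_time_smul_basisVector a x.1 θ
  have hdevθ : ∀ θ ∈ Icc (0 : ℝ) s, ∀ h : x.1 + θ • E4.basisVector 0 ∈ ((Kerr.background M a).domain : Set E4),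
      ‖𝒟.toSpacetime.deviation (Kerr.background M a) Ψ ⟨x.1 + θ • E4.basisVector 0, h⟩‖ ≤ 1 / 20 := by
    intro θ hθ h
    refine hdev _ ?_ ?_ ?_
    · show x.1 0 ≤ (x.1 + θ • E4.basisVector 0) 0
      rw [add_smul_basisVector_zero_apply_zero]; linarith [hθ.1]
    · show (x.1 + θ • E4.basisVector 0) 0 ≤ x.1 0 + s
      rw [add_smul_basisVector_zero_apply_zero]; linarith [hθ.2]
    · exact Kerr.spatial_add_smul_basisVector_zero x.1 θ
  -- (1) causal velocities along the segment
  have hc : ∀ θ ∈ Icc (0 : ℝ) s, ∀ h : x.1 + θ • E4.basisVector 0 ∈ ((Kerr.background M a).domain : Set E4),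
      𝒟.toSpacetime.metric.IsCausal
        (mfderiv 𝓘(ℝ, E4) (𝓡 4) Ψ ⟨x.1 + θ • E4.basisVector 0, h⟩ (E4.basisVector 0)) :=
    fun θ hθ h ↦ isCausal_mfderiv_basisVector 𝒟.toSpacetime a hM Ψ _ (by rw [hrad]; exact hr)
      (hdevθ θ hθ h)
  -- (2) future-directedness at the start, from `dΨ V` future-directed and `g(dΨ V, dΨ e₀) < 0`
  have hx : 0 < Kerr.radius a x.1 := Kerr.radius_pos_of_mem_region x.2
  have hH : Kerr.scalarH M a x.1 ≤ 1 / 100 := scalarH_le_of_radius hM hx hr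
  have hdevx : ‖𝒟.toSpacetime.deviation (Kerr.background M a) Ψ x‖ ≤ 1 / 20 :=
    hdev x le_rfl (by linarith) rfl
  have hcx : 𝒟.toSpacetime.metric.IsCausal (mfderiv 𝓘(ℝ, E4) (𝓡 4) Ψ x (E4.basisVector 0)) :=
    isCausal_mfderiv_basisVector 𝒟.toSpacetime a hM Ψ x hr hdevx
  have hcross : 𝒟.toSpacetime.metric.val (Ψ x) (mfderiv 𝓘(ℝ, E4) (𝓡 4) Ψ x (Kerr.timeVector M a x.1))
      (mfderiv 𝓘(ℝ, E4) (𝓡 4) Ψ x (E4.basisVector 0)) < 0 := by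
    have hmodel : (Kerr.background M a).bilin x.1 (Kerr.timeVector M a x.1) (E4.basisVector 0) ≤ -1 := by
      have h := Kerr.bilin_timeVector (M := M) hx (E4.basisVector 0)
      have h1 : (E4.basisVector 0 : E4) 0 = 1 := by simp
      rw [h1] at h
      exact le_of_eq h
    have h := val_mfderiv_le_of_norm_deviation_le 𝒟.toSpacetime (Kerr.background M a) Ψ x hdevx _ _ hmodel
    have hVn := norm_timeVector_le hM hx hH
    rw [norm_basisVector_zero', mul_one] at h
    have : 1 / 20 * ‖Kerr.timeVector M a x.1‖ ≤ 1 / 20 * 2 := by gcongr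
    linarith
  have h0 : 𝒟.toSpacetime.timeOrientation.IsFutureDirected
      (mfderiv 𝓘(ℝ, E4) (𝓡 4) Ψ x (E4.basisVector 0)) := by
    rcases 𝒟.toSpacetime.timeOrientation.isFutureDirected_or_isPastDirected_of_isCausal hcx with h | h
    · exact h
    · exfalso
      have h' := (𝒟.toSpacetime.timeOrientation.isFutureDirected_neg_iff _).2 h
      have := hV.val_nonpos _ h'
      rw [map_neg] at this
      linarith
  -- (3) the leg
  have key := BoostedKerrLegs.leg_two_causal 𝒟.toSpacetime (Kerr.background M a) Ψ
    (V := ((Kerr.background M a).domain : Set E4)) (Kerr.background M a).domain.isOpen subset_rfl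
    hΨ.contMDiffOn x.1 (E4.basisVector 0) hs (fun θ _ ↦ hmem θ) hc x.2 (hmem s) h0
  refine ⟨⟨x.1 + s • E4.basisVector 0, hmem s⟩, rfl, ?_⟩
  exact LorentzianMetric.mem_causalPast_singleton_iff.2 key


end Summit.FinalStateConjecture.FinalStateConjecture.Theorems.DissipativeFinalMotions.DispersingCapture

end
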